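import Summits.NavierStokesRegularity.NavierStokesRegularity.Theorems.HeredityFromTwo.Negative.GlobalDesigns
import Literature.Analysis.FluidPDE.KatoGlobalSmallHolds
import Literature.Analysis.FluidPDE.NSKatoToClayHolds
import Mathlib.Analysis.SpecialFunctions.JapaneseBracket

/-!
# KJ-12 — registered unforced designs are KATO-LARGE: the small-`L³` class is emptied under the
heredity binders, cap-free and UNCONDITIONALLY (Kato 1984 is a theorem of the tree)

Third typed line of the T2 ∀-form lever (after KJ-10 `…/EpisodeInduction/Negative/GlobalDesigns.lean`
= global classical design / no-swirl, and KJ-11 `…/HeredityFromTwo/Negative/GlobalDesigns.lean` = every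
starting level): the planner's hygiene line (STATUS l.4085 (2): «small-data classes — Re = O(1), not
provably small») made KERNEL. Kato's small-data global theorem is DISCHARGED in the tree
(`kato_global_small_holds`, Kato 1984 Thm. 2: `‖u₀‖_{L³} ≤ δν` ⇒ global Kato solution) and so is the
passage Kato ⇒ Clay (`clay_solution_of_hasGlobalKatoSolution_holds`, von Wahl / Lemarié-Rieusset
Prop. 12.3); composed with the design-remembering realisation of KJ-11
(`Schedule.exists_realisation_of_nonempty_stages`) and the `hU`-free contradiction
`Realisation.not_exists_claySolution` (Tao 2013 Cor. 11.4, discharged), they give, with ONE absolute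
constant `δ > 0` (Kato's):

* §0 glue — a Clay datum is a Kato datum: `memLp_three_of_hasRapidSpatialDecay`,
  `isWeaklyDivFree_of_contDiff_of_isDivFree`; `exists_kato_clay_threshold` (small-data Clay (A) at every
  viscosity, unconditional).
* §1 `Realisation.exists_kato_threshold_datum` — EVERY UNFORCED REALISATION HAS A KATO-LARGE DATUM:
  `δν < ‖W.u 0‖_{L³}` (any rates `R`, any `ν > 0`).
* §2 register (wide, `ν = 1`): `HeredityFrom.exists_threshold_isEmpty_stage_of_small_L3` — under
  `HeredityFrom k₀` no pinned rigid quiet UNFORCED schedule with `‖u₀‖_{L³} ≤ δ` carries a registered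
  stage at level `k₀`; equivalently every registered unforced design at level `≥ k₀` has `‖u₀‖_{L³} > δ`
  (`HeredityFrom.exists_threshold_lt_eLpNorm_datum`); parent form for `EpisodeInductionG` (k₀ = 1).
* §3 the same by the route's decl names (`PalasekTowerBreakdownNegative.…_of_small_L3_design`).

No cap, no sign condition, no Clay (A) hypothesis: the class «unforced, `‖u₀‖₃ ≤ δ`» joins «globally
classical design» and «axisymmetric swirl-free» as binder sub-classes that are typed-empty under the
items. Premise empty-in-practice as before (a registered level-1 feature has `Re ≈ 5`, K61 / S-RING-1);
filed PLAIN (`--supports` 19250), not `--negative-modulo`.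

References: T. Kato, Math. Z. 187 (1984) 471–480, Thm. 2 [cite: Kato1984MathZ, Thm. 2 (p. 472)];
P. G. Lemarié-Rieusset, *The Navier–Stokes Problem in the 21st Century*, CRC 2016, Thm. 7.5, Prop. 12.3
[cite: LemarieRieusset2016, Prop. 12.3 (p. 393)]; T. Tao, Anal. PDE 6 (2013), Cor. 11.4
[cite: Tao2011, Cor. 11.4]; S. Palasek, arXiv:2605.13827 §4 [cite: Palasek2026ElementaryModel, §4].
-/

noncomputable section

namespace Summit.NavierStokesRegularity.FluidComputer.PalasekTowerClayBridge

open Set MeasureTheory Filter Topology Function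
open scoped ENNReal ContDiff NNReal
open Literature.Analysis.FluidPDE

/-! ## §0 A Clay datum is a Kato datum -/

/-- A continuous rapidly decaying field on `ℝ³` lies in `L³`: `‖u₀(x)‖ ≤ C (1 + ‖x‖)⁻²` (decay with
`n = 0`, `K = 2`) and `(1 + ‖x‖)⁻⁶ ∈ L¹(ℝ³)`. [folklore] -/
theorem memLp_three_of_hasRapidSpatialDecay
    {u₀ : EuclideanSpace ℝ (Fin 3) → EuclideanSpace ℝ (Fin 3)} (hc : Continuous u₀)
    (hd : HasRapidSpatialDecay u₀) : MemLp u₀ 3 volume := by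
  obtain ⟨C, hC⟩ := hd 0 2
  have hb : ∀ x, ‖u₀ x‖ ≤ C * (1 + ‖x‖) ^ (-(2 : ℝ)) := fun x => by
    have h := hC x
    rw [norm_iteratedFDeriv_zero] at h
    have hpos : 0 < 1 + ‖x‖ := by positivity
    rw [Real.rpow_neg hpos.le, ← div_eq_mul_inv, le_div_iff₀ (by positivity), Real.rpow_two]
    linarith [h]
  have hC0 : 0 ≤ C := by
    have h := hC 0
    rw [norm_iteratedFDeriv_zero] at h
    exact le_trans (by positivity) h
  have hmeas : AEStronglyMeasurable u₀ volume := hc.aestronglyMeasurable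
  refine (integrable_norm_rpow_iff hmeas (by norm_num) (by norm_num)).1 ?_
  have h6 : (Module.finrank ℝ (EuclideanSpace ℝ (Fin 3)) : ℝ) < 6 := by
    rw [finrank_euclideanSpace_fin]; norm_num
  refine ((integrable_one_add_norm h6).const_mul (C ^ (3 : ℝ))).mono' ?_ (Eventually.of_forall fun x => ?_)
  · exact (hc.norm.rpow_const fun _ => Or.inr (by norm_num)).aestronglyMeasurable
  · have hpos : 0 < 1 + ‖x‖ := by positivity
    rw [Real.norm_of_nonneg (by positivity), ENNReal.toReal_ofNat]
    calc ‖u₀ x‖ ^ (3 : ℝ) ≤ (C * (1 + ‖x‖) ^ (-(2 : ℝ))) ^ (3 : ℝ) :=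
          Real.rpow_le_rpow (norm_nonneg _) (hb x) (by norm_num)
      _ = C ^ (3 : ℝ) * (1 + ‖x‖) ^ (-(6 : ℝ)) := by
          rw [Real.mul_rpow hC0 (Real.rpow_nonneg hpos.le _), ← Real.rpow_mul hpos.le]
          norm_num

/-- A `C¹` pointwise divergence-free field is weakly divergence free (`NSWave0.IsDivFree` is verbatim
`VectorCalculus.IsDivFree`, discharged `VectorCalculus.IsDivFree.isWeaklyDivFree_holds`).
[cite: Evans2010, App. C.2 Thm. 2] -/
theorem isWeaklyDivFree_of_contDiff_of_isDivFree
    {u₀ : EuclideanSpace ℝ (Fin 3) → EuclideanSpace ℝ (Fin 3)} (hsm : ContDiff ℝ ∞ u₀)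
    (hdiv : NSWave0.IsDivFree u₀) : IsWeaklyDivFree u₀ :=
  VectorCalculus.IsDivFree.isWeaklyDivFree_holds hdiv (hsm.of_le (by exact_mod_cast le_top))

/-- **Small-data Clay (A), unconditional, every viscosity**: with Kato's absolute constant `δ > 0`,
every smooth divergence-free rapidly decaying datum with `‖u₀‖_{L³} ≤ δν` has a global smooth
bounded-energy solution of the unforced system (`kato_global_small_holds` ∘
`clay_solution_of_hasGlobalKatoSolution_holds`). [cite: Kato1984MathZ, Thm. 2 (p. 472)] -/
theorem exists_kato_clay_threshold :
    ∃ δ : ℝ, 0 < δ ∧ ∀ ν : ℝ, 0 < ν →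
      ∀ u₀ : EuclideanSpace ℝ (Fin 3) → EuclideanSpace ℝ (Fin 3),
        ContDiff ℝ ∞ u₀ → NSWave0.IsDivFree u₀ → HasRapidSpatialDecay u₀ →
        eLpNorm u₀ 3 volume ≤ ENNReal.ofReal (δ * ν) →
        ∃ (u : ℝ → EuclideanSpace ℝ (Fin 3) → EuclideanSpace ℝ (Fin 3))
          (p : ℝ → EuclideanSpace ℝ (Fin 3) → ℝ),
          IsSmoothOnHalfSpace u ∧ IsSmoothOnHalfSpace p ∧ IsNavierStokesSolution ν 0 u₀ u p ∧
            HasBoundedEnergy u := by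
  obtain ⟨δ, hδ, h⟩ := kato_global_small_holds
  refine ⟨δ, hδ, fun ν hν u₀ hsm hdiv hdec hsmall => ?_⟩
  obtain ⟨u, hg, hcont, h0, hm, -, -⟩ := h ν hν u₀
    (memLp_three_of_hasRapidSpatialDecay hsm.continuous hdec)
    (isWeaklyDivFree_of_contDiff_of_isDivFree hsm hdiv) hsmall
  exact clay_solution_of_hasGlobalKatoSolution_holds ν hν u₀ hsm hdiv hdec ⟨u, hg, hcont, h0, hm⟩

/-! ## §1 Every unforced realisation has a Kato-large datum -/

/-- **EVERY UNFORCED REALISATION HAS A KATO-LARGE DATUM**: with Kato's absolute `δ > 0`, a realisation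
of the tower (any rates, any `ν > 0`) with force `f ≡ 0` has `‖u(0)‖_{L³} > δν` — else its datum would
have a global Clay solution, which `Realisation.not_exists_claySolution` (`hU` discharged) forbids.
[cite: Kato1984MathZ, Thm. 2 (p. 472)] [cite: Tao2011, Cor. 11.4] -/
theorem Realisation.exists_kato_threshold_datum :
    ∃ δ : ℝ, 0 < δ ∧ ∀ (ν : ℝ) (R : TowerRates) (W : Realisation ν R), 0 < ν → W.f = 0 →
      ENNReal.ofReal (δ * ν) < eLpNorm (W.u 0) 3 volume := by
  obtain ⟨δ, hδ, h⟩ := exists_kato_clay_threshold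
  refine ⟨δ, hδ, fun ν R W hν hf => not_le.1 fun hsmall => ?_⟩
  obtain ⟨v, q, hv, hq, hns, hE⟩ := h ν hν (W.u 0) W.contDiff_datum W.divFree_datum W.datum_decay hsmall
  refine W.not_exists_claySolution tao_unconditional_uniqueness_velocity_forced_holds hν
    ⟨v, q, hv, hq, ?_, hE⟩
  rw [hf]
  exact hns

/-- **An UNFORCED design that reaches every level is Kato-large** (design-remembering realisation,
`Schedule.exists_realisation_of_nonempty_stages`). [cite: Kato1984MathZ, Thm. 2 (p. 472)] -/
theorem Schedule.exists_kato_threshold_of_nonempty_stages :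
    ∃ δ : ℝ, 0 < δ ∧ ∀ (ν : ℝ) (R : TowerRates) (S : Schedule R), 0 < ν →
      (∀ k, Nonempty (Stage ν R S (Margins.routeG R) k)) → S.f = 0 →
      ENNReal.ofReal (δ * ν) < eLpNorm S.u₀ 3 volume := by
  obtain ⟨δ, hδ, h⟩ := Realisation.exists_kato_threshold_datum
  refine ⟨δ, hδ, fun ν R S hν hall hf => ?_⟩
  obtain ⟨W, hWf, hu, -⟩ := S.exists_realisation_of_nonempty_stages hν hall
  rw [← hu]
  exact h ν R W hν (hWf.trans hf)

/-! ## §2 The register (wide rates, `ν = 1`): the small-`L³` class is emptied at every level -/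

section Lever

/-- **UNDER `HeredityFrom k₀` EVERY REGISTERED UNFORCED DESIGN IS KATO-LARGE**: one absolute `δ > 0`
such that, for every starting level `k₀`, every pinned rigid quiet wide schedule with `f ≡ 0` carrying a
registered level-`k₀` stage has `‖u₀‖_{L³} > δ`. Cap-free, unconditional (Kato and `hU` discharged).
[cite: Kato1984MathZ, Thm. 2 (p. 472)] [cite: Palasek2026ElementaryModel, §4] -/
theorem HeredityFrom.exists_threshold_lt_eLpNorm_datum :
    ∃ δ : ℝ, 0 < δ ∧ ∀ (k₀ : ℕ) (S : Schedule TowerRates.wide), HeredityFrom k₀ → S.Pins 8 (6 / 5) →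
      S.Rigid → S.Quiet → S.f = 0 →
      Nonempty (Stage 1 TowerRates.wide S (Margins.routeG TowerRates.wide) k₀) →
      ENNReal.ofReal δ < eLpNorm S.u₀ 3 volume := by
  obtain ⟨δ, hδ, h⟩ := Schedule.exists_kato_threshold_of_nonempty_stages
  refine ⟨δ, hδ, fun k₀ S hH hP hR hQ hf ⟨s⟩ => ?_⟩
  simpa using h 1 TowerRates.wide S one_pos (hH.nonempty_stage_all hP hR hQ s) hf

/-- **THE SMALL-`L³` CLASS IS EMPTIED UNDER `HeredityFrom k₀`**: no pinned rigid quiet UNFORCED wide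
schedule with `‖u₀‖_{L³} ≤ δ` (Kato's absolute `δ`) carries a registered stage at level `k₀`.
[cite: Kato1984MathZ, Thm. 2 (p. 472)] -/
theorem HeredityFrom.exists_threshold_isEmpty_stage_of_small_L3 :
    ∃ δ : ℝ, 0 < δ ∧ ∀ (k₀ : ℕ) (S : Schedule TowerRates.wide), HeredityFrom k₀ → S.Pins 8 (6 / 5) →
      S.Rigid → S.Quiet → S.f = 0 → eLpNorm S.u₀ 3 volume ≤ ENNReal.ofReal δ →
      IsEmpty (Stage 1 TowerRates.wide S (Margins.routeG TowerRates.wide) k₀) := by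
  obtain ⟨δ, hδ, h⟩ := HeredityFrom.exists_threshold_lt_eLpNorm_datum
  exact ⟨δ, hδ, fun k₀ S hH hP hR hQ hf hsmall =>
    ⟨fun s => absurd (h k₀ S hH hP hR hQ hf ⟨s⟩) (not_lt.2 hsmall)⟩⟩

/-- **`HeredityFrom k₀` is refuted by ONE registered Kato-small unforced design at level `k₀`** (the
lever, packaged; premise empty-in-practice — a registered feature has `Re ≈ 5`).
[cite: Kato1984MathZ, Thm. 2 (p. 472)] -/
theorem exists_threshold_not_heredityFrom_of_small_L3_design :
    ∃ δ : ℝ, 0 < δ ∧ ∀ k₀ : ℕ,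
      (∃ (S : Schedule TowerRates.wide)
        (_ : Stage 1 TowerRates.wide S (Margins.routeG TowerRates.wide) k₀),
        S.Pins 8 (6 / 5) ∧ S.Rigid ∧ S.Quiet ∧ S.f = 0 ∧ eLpNorm S.u₀ 3 volume ≤ ENNReal.ofReal δ) →
      ¬ HeredityFrom k₀ := by
  obtain ⟨δ, hδ, h⟩ := HeredityFrom.exists_threshold_isEmpty_stage_of_small_L3
  refine ⟨δ, hδ, fun k₀ ⟨S, s, hP, hR, hQ, hf, hsmall⟩ hH => ?_⟩
  exact (h k₀ S hH hP hR hQ hf hsmall).false s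

/-- **Parent form (K2G = `EpisodeInductionG` = `HeredityFrom 1`)**: under K2G every registered unforced
design at level `1` has `‖u₀‖_{L³} > δ`, and the Kato-small unforced class carries no registered
level-1 stage. [cite: Kato1984MathZ, Thm. 2 (p. 472)] -/
theorem EpisodeInductionG.exists_threshold_isEmpty_stage_of_small_L3 :
    ∃ δ : ℝ, 0 < δ ∧ ∀ S : Schedule TowerRates.wide, EpisodeInductionG → S.Pins 8 (6 / 5) →
      S.Rigid → S.Quiet → S.f = 0 → eLpNorm S.u₀ 3 volume ≤ ENNReal.ofReal δ →
      IsEmpty (Stage 1 TowerRates.wide S (Margins.routeG TowerRates.wide) 1) := by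
  obtain ⟨δ, hδ, h⟩ := HeredityFrom.exists_threshold_isEmpty_stage_of_small_L3
  exact ⟨δ, hδ, fun S h₂ hP hR hQ hf hsmall =>
    h 1 S (episodeInductionG_iff_heredityFrom_one.1 h₂) hP hR hQ hf hsmall⟩

/-- **K2G is refuted by ONE registered Kato-small unforced design at level 1.**
[cite: Kato1984MathZ, Thm. 2 (p. 472)] -/
theorem exists_threshold_not_episodeInductionG_of_small_L3_design :
    ∃ δ : ℝ, 0 < δ ∧
      ((∃ (S : Schedule TowerRates.wide)
        (_ : Stage 1 TowerRates.wide S (Margins.routeG TowerRates.wide) 1),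
        S.Pins 8 (6 / 5) ∧ S.Rigid ∧ S.Quiet ∧ S.f = 0 ∧ eLpNorm S.u₀ 3 volume ≤ ENNReal.ofReal δ) →
      ¬ EpisodeInductionG) := by
  obtain ⟨δ, hδ, h⟩ := exists_threshold_not_heredityFrom_of_small_L3_design
  exact ⟨δ, hδ, fun hex h₂ => h 1 hex (episodeInductionG_iff_heredityFrom_one.1 h₂)⟩

end Lever

end Summit.NavierStokesRegularity.FluidComputer.PalasekTowerClayBridge

/-! ## §3 The same, by the route's decl names -/

namespace Summit.NavierStokesRegularity.PalasekTowerBreakdownNegative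

open Set MeasureTheory
open scoped ENNReal
open Summit.NavierStokesRegularity.NavierStokesRegularity.Theses
open Summit.NavierStokesRegularity.FluidComputer.PalasekTowerClayBridge
open Literature.Analysis.FluidPDE

/-- **`PalasekTowerBreakdown.HeredityFromTwo` (stmt-19250) is refuted by ONE registered Kato-small
unforced design at a level `k₀ ≥ 2`** — cap-free, unconditional; premise empty-in-practice.
[cite: Kato1984MathZ, Thm. 2 (p. 472)] -/
theorem palasekTowerBreakdown_exists_threshold_not_heredityFromTwo_of_small_L3_design :
    ∃ δ : ℝ, 0 < δ ∧
      ((∃ (S : Schedule TowerRates.wide) (k₀ : ℕ)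
        (_ : Stage 1 TowerRates.wide S (Margins.routeG TowerRates.wide) k₀),
        2 ≤ k₀ ∧ S.Pins 8 (6 / 5) ∧ S.Rigid ∧ S.Quiet ∧ S.f = 0 ∧
          eLpNorm S.u₀ 3 volume ≤ ENNReal.ofReal δ) →
      ¬ PalasekTowerBreakdown.HeredityFromTwo) := by
  obtain ⟨δ, hδ, h⟩ := HeredityFrom.exists_threshold_isEmpty_stage_of_small_L3
  refine ⟨δ, hδ, fun ⟨S, k₀, s, hk, hP, hR, hQ, hf, hsmall⟩ h₃ => ?_⟩
  exact (h k₀ S ((h₃ : HeredityFrom 2).mono hk) hP hR hQ hf hsmall).false s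

/-- **`PalasekTowerBreakdown.EpisodeInduction` (stmt-19178, the parent) is refuted by ONE registered
Kato-small unforced design at level 1.** [cite: Kato1984MathZ, Thm. 2 (p. 472)] -/
theorem palasekTowerBreakdown_exists_threshold_not_episodeInduction_of_small_L3_design :
    ∃ δ : ℝ, 0 < δ ∧
      ((∃ (S : Schedule TowerRates.wide)
        (_ : Stage 1 TowerRates.wide S (Margins.routeG TowerRates.wide) 1),
        S.Pins 8 (6 / 5) ∧ S.Rigid ∧ S.Quiet ∧ S.f = 0 ∧ eLpNorm S.u₀ 3 volume ≤ ENNReal.ofReal δ) →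
      ¬ PalasekTowerBreakdown.EpisodeInduction) :=
  exists_threshold_not_episodeInductionG_of_small_L3_design

/-- **Under the pair of items 19249 ∧ 19250 (hence under K2G) every registered UNFORCED design is
Kato-large at every level**: `‖u₀‖_{L³} > δ`. [cite: Kato1984MathZ, Thm. 2 (p. 472)] -/
theorem palasekTowerBreakdown_exists_threshold_lt_eLpNorm_datum_of_heredity_pair :
    ∃ δ : ℝ, 0 < δ ∧ ∀ (k₀ : ℕ) (S : Schedule TowerRates.wide), 1 ≤ k₀ →
      PalasekTowerBreakdown.HeredityAtOne → PalasekTowerBreakdown.HeredityFromTwo →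
      S.Pins 8 (6 / 5) → S.Rigid → S.Quiet → S.f = 0 →
      Nonempty (Stage 1 TowerRates.wide S (Margins.routeG TowerRates.wide) k₀) →
      ENNReal.ofReal δ < eLpNorm S.u₀ 3 volume := by
  obtain ⟨δ, hδ, h⟩ := HeredityFrom.exists_threshold_lt_eLpNorm_datum
  refine ⟨δ, hδ, fun k₀ S hk h₂ h₃ hP hR hQ hf hs => ?_⟩
  have h₁ : HeredityFrom 1 :=
    episodeInductionG_iff_heredityFrom_one.1 (PalasekTowerBreakdown.EpisodeInductionGlueBy_holds h₂ h₃)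
  exact h k₀ S (h₁.mono hk) hP hR hQ hf hs

end Summit.NavierStokesRegularity.PalasekTowerBreakdownNegative

end
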